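import Summits.ResolutionOfSingularities.ResolutionOfSingularities.Theorems.FrobeniusLadderFRationalResolutionFixedPointResolvableNhd
import Summits.ResolutionOfSingularities.ResolutionOfSingularities.Theorems.FrobeniusLadderFRationalResolutionSimplicialConePrimSimplicial
import Summits.ResolutionOfSingularities.ResolutionOfSingularities.Theorems.FrobeniusLadderFRationalResolutionKernelLattice
import Literature.AlgebraicGeometry.Resolution.LogBlowupOrthant
import Literature.Geometry.PolyhedralFans.RegularBasis
import HarnessLib

/-!
# Crux `FrobeniusLadder.FRationalResolution` (stmt-ResolutionOfSingularities-15317), line `redirect`,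
# stub `stub_diagonalizableQuotientResolution` — the NORMALISED fixed-point chart monoid has a PRIMITIVELY SIMPLICIAL
# face fan (hypothesis `hps` of the assemblies (ε₁′)/(ε₂′)/(ε₂″) at `D(A)`-fixed points)

The fixed-point chart monoid of `…FixedPointLogRegular[Nhd]` is `P = ℤⁿ_{≥0} ⊓ K`, `K = ker(m ↦ Σ mᵢ aᵢ)` (all `aᵢ` of
finite order, so `N ℤⁿ ⊆ K`, `N = ∏ ord aᵢ`). Its normalisation (`…ChartNormalization`, `…FixedPointResolvableNhd.
exists_normalized_chart_forall`) is `P' = L⁻¹(P) = {v : L v ≥ 0}` for an injective `L : ℤⁿ → ℤⁿ` with image `K`: the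
preimage of an ORTHANT. Here we compute its dual cone: with `ℓᵢ ∈ ℤⁿ` the rows of `L` (`(L v)ᵢ = ℓᵢ · v`) and
`uⱼ ∈ P'` with `L uⱼ = N eⱼ` (test vectors), the `ℓᵢ` are linearly independent over `ℚ` (pair a relation with `uⱼ`)
and `P'^∨ = hull{ℓᵢ}` (`⊇` since `ℓᵢ · p = (L p)ᵢ ≥ 0`; `⊆`: write `w = Σ cᵢ ℓᵢ` in the `ℚ`-basis `ℓ`, then
`0 ≤ uⱼ · w = N cⱼ`). So `P'^∨` is the hull of linearly independent lattice vectors and its face fan is primitively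
simplicial (`Fan.isPrimSimplicial_ofCone_hull`, ✓ p824090).

* `apply_eq_dotProduct`, `toRat_dotProduct_row` — `(L v)ᵢ = ℓᵢ · v`, also after casting to `ℚ`;
* `linearIndependent_rows_and_dualCone_eq` — the computation above;
* `isPrimSimplicial_ofCone_dualCone_of_preimage_orthant` — the face fan of `P'^∨` is primitively simplicial;
* **`exists_normalized_chart_forall_isPrimSimplicial`** — `…exists_normalized_chart_forall` with the extra conclusion
  (same construction; the fan clause is new).

Honest label: fan/lattice bookkeeping (no stub closed). No definitions, no named facts, no sorry.
[cite: Kato1994, (1.5), Def. (2.1)] [cite: Fulton1993Toric, §1.2 (2), §1.3, §2.1]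
-/

-- single-problem summit: the doubled namespace component is forced
set_option linter.dupNamespace false

open Literature.AlgebraicGeometry.Resolution Literature.Geometry.PolyhedralFans PointedCone
open Literature.AlgebraicGeometry.Resolution.LogBlowup
open Literature.Combinatorics.Optimization.HilbertBasis (toRat)
open Summit.ResolutionOfSingularities.ResolutionOfSingularities.Theorems.FRationalResolution

namespace Summit.ResolutionOfSingularities.ResolutionOfSingularities.Theorems.FRationalResolution.SimplicialNormalization

universe u w

variable {n : ℕ}

/-! ## Rows of a linear endomorphism of `ℤⁿ` -/

/-- `(L v)ᵢ = ℓᵢ · v` with `ℓᵢ` the `i`-th row of `L`. [folklore] -/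
theorem apply_eq_dotProduct (L : (Fin n → ℤ) →ₗ[ℤ] (Fin n → ℤ)) (v : Fin n → ℤ) (i : Fin n) :
    L v i = (fun j => L (fun k => if j = k then (1 : ℤ) else 0) i) ⬝ᵥ v := by
  rw [LinearMap.pi_apply_eq_sum_univ L v, Finset.sum_apply, dotProduct]
  refine Finset.sum_congr rfl fun j _ => ?_
  rw [Pi.smul_apply, smul_eq_mul, mul_comm]

/-- `v · ℓᵢ = (L v)ᵢ` after casting to `ℚ`. [folklore] -/
theorem toRat_dotProduct_row (L : (Fin n → ℤ) →ₗ[ℤ] (Fin n → ℤ)) (v : Fin n → ℤ) (i : Fin n) :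
    toRat v ⬝ᵥ toRat (fun j => L (fun k => if j = k then (1 : ℤ) else 0) i) = ((L v i : ℤ) : ℚ) := by
  rw [apply_eq_dotProduct, dotProduct_comm _ v]
  exact intCast_dotProduct_intCast v _

/-! ## The dual cone of the preimage of an orthant -/

/-- **Dual cone of the preimage of an orthant.** Let `L : ℤⁿ → ℤⁿ` be `ℤ`-linear, `P' = {v : L v ≥ 0}`, and suppose
there are `uⱼ` with `L uⱼ = N eⱼ`, `N > 0`. Then the rows `ℓᵢ` of `L` are linearly independent over `ℚ` and
`P'^∨ = hull{ℓᵢ}`. [cite: Fulton1993Toric, §1.2 (2), §1.3] -/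
theorem linearIndependent_rows_and_dualCone_eq (L : (Fin n → ℤ) →ₗ[ℤ] (Fin n → ℤ))
    (P' : AddSubmonoid (Fin n → ℤ)) (hP' : ∀ v, v ∈ P' ↔ 0 ≤ L v)
    (N : ℕ) (hN : 0 < N) (u : Fin n → Fin n → ℤ) (hu : ∀ j, L (u j) = (N : ℤ) • Pi.single j 1) :
    LinearIndependent ℚ (fun i => toRat (fun j => L (fun k => if j = k then (1 : ℤ) else 0) i)) ∧
      dualCone P' = PointedCone.hull ℚ
        (Set.range fun i => toRat (fun j => L (fun k => if j = k then (1 : ℤ) else 0) i)) := by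
  classical
  set f : Fin n → (Fin n → ℚ) := fun i => toRat (fun j => L (fun k => if j = k then (1 : ℤ) else 0) i) with hf
  have key : ∀ (v : Fin n → ℤ) (i : Fin n), toRat v ⬝ᵥ f i = ((L v i : ℤ) : ℚ) := fun v i =>
    toRat_dotProduct_row L v i
  have hpair : ∀ (c : Fin n → ℚ) (v : Fin n → ℤ), toRat v ⬝ᵥ (∑ i, c i • f i) = ∑ i, c i * ((L v i : ℤ) : ℚ) := by
    intro c v
    rw [dotProduct_sum]
    exact Finset.sum_congr rfl fun i _ => by rw [dotProduct_smul, smul_eq_mul, key]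
  have htest : ∀ (c : Fin n → ℚ) (j : Fin n), ∑ i, c i * ((L (u j) i : ℤ) : ℚ) = c j * N := by
    intro c j
    have hLu : ∀ i, ((L (u j) i : ℤ) : ℚ) = if i = j then (N : ℚ) else 0 := fun i => by
      rw [hu j, Pi.smul_apply, Pi.single_apply, smul_eq_mul]
      split_ifs <;> simp
    simp_rw [hLu, mul_ite, mul_zero]
    rw [Finset.sum_ite_eq' Finset.univ j]
    simp
  have hu_mem : ∀ j, u j ∈ P' := fun j => (hP' _).mpr (by
    rw [hu j]
    intro i
    simp only [Pi.zero_apply, Pi.smul_apply, Pi.single_apply, smul_eq_mul]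
    split_ifs <;> simp)
  -- linear independence of the rows
  have hli : LinearIndependent ℚ f := by
    rw [Fintype.linearIndependent_iff]
    intro g hg j
    have h := congrArg (fun w => toRat (u j) ⬝ᵥ w) hg
    simp only [dotProduct_zero] at h
    rw [hpair, htest] at h
    exact (mul_eq_zero.mp h).resolve_right (by exact_mod_cast hN.ne')
  refine ⟨hli, le_antisymm ?_ ?_⟩
  · -- `P'^∨ ⊆ hull{ℓᵢ}`: expand in the basis `ℓ` and test against the `uⱼ`
    intro w hw
    let b : Module.Basis (Fin n) ℚ (Fin n → ℚ) := basisOfPiSpaceOfLinearIndependent hli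
    have hb : ∀ i, b i = f i := fun i => by simp [b]
    have hw_eq : w = ∑ i, b.repr w i • f i := by
      conv_lhs => rw [← b.sum_repr w]
      simp only [hb]
    have hc_nonneg : ∀ j, 0 ≤ b.repr w j := by
      intro j
      have h1 : 0 ≤ toRat (u j) ⬝ᵥ w := (mem_dualCone_iff P').mp hw _ (hu_mem j)
      rw [hw_eq, hpair, htest] at h1
      exact (mul_nonneg_iff_of_pos_right (by exact_mod_cast hN)).mp h1
    rw [hw_eq]
    refine Submodule.sum_mem _ fun i _ => ?_
    have hsmul : (b.repr w i • f i : Fin n → ℚ) = (⟨b.repr w i, hc_nonneg i⟩ : ℚ≥0) • f i := rfl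
    rw [hsmul]
    exact Submodule.smul_mem _ _ (PointedCone.subset_hull ⟨i, rfl⟩)
  · -- `hull{ℓᵢ} ⊆ P'^∨`
    rw [Submodule.span_le]
    rintro _ ⟨i, rfl⟩
    show f i ∈ dualCone P'
    refine (mem_dualCone_iff P').mpr fun p hp => ?_
    rw [key]
    exact_mod_cast (hP' p).mp hp i

/-- **The face fan of `P'^∨` is primitively simplicial** for `P' = {v : L v ≥ 0}` as above (finitely generated and
spanning, so that the face fan is defined). [cite: Fulton1993Toric, §1.2 (2), §2.1] -/
theorem isPrimSimplicial_ofCone_dualCone_of_preimage_orthant (L : (Fin n → ℤ) →ₗ[ℤ] (Fin n → ℤ))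
    (P' : AddSubmonoid (Fin n → ℤ)) (hP' : ∀ v, v ∈ P' ↔ 0 ≤ L v)
    (N : ℕ) (hN : 0 < N) (u : Fin n → Fin n → ℤ) (hu : ∀ j, L (u j) = (N : ℤ) • Pi.single j 1)
    (hfg : P'.FG) (hspan : Submodule.span ℤ (P' : Set (Fin n → ℤ)) = ⊤) :
    (Fan.ofCone (dualCone P') (dualCone_fg P' hfg) (isSalient_dualCone P' hspan)).IsPrimSimplicial := by
  classical
  obtain ⟨hli, heq⟩ := linearIndependent_rows_and_dualCone_eq L P' hP' N hN u hu
  set f : Fin n → (Fin n → ℚ) := fun i => toRat (fun j => L (fun k => if j = k then (1 : ℤ) else 0) i) with hf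
  set S : Finset (Fin n → ℚ) := Finset.univ.image f with hS
  have hcoe : (S : Set (Fin n → ℚ)) = Set.range f := by
    rw [hS, Finset.coe_image, Finset.coe_univ, Set.image_univ]
  have hSN : ∀ s ∈ S, s ∈ latticeN (Fin n) := by
    intro s hs
    obtain ⟨i, -, rfl⟩ := Finset.mem_image.mp hs
    exact fun j => ⟨_, rfl⟩
  have hliS : LinearIndepOn ℚ id (S : Set (Fin n → ℚ)) := by
    rw [hcoe]
    exact hli.linearIndepOn_id
  have key : ∀ (σ : PointedCone ℚ (Fin n → ℚ)) (h1 : σ.FG) (h2 : IsSalient σ),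
      σ = PointedCone.hull ℚ (S : Set (Fin n → ℚ)) → (Fan.ofCone σ h1 h2).IsPrimSimplicial := by
    rintro σ h1 h2 rfl
    exact Fan.isPrimSimplicial_ofCone_hull hSN hliS h1 h2
  exact key _ _ _ (heq.trans (by rw [hcoe]))

/-! ## Chart normalisation with the fan clause -/

/-- **Chart normalisation (all primes) with a primitively simplicial face fan.** For `aᵢ` of finite order, every
chart `φ` on `P = ℤⁿ_{≥0} ⊓ ker(m ↦ Σ mᵢ aᵢ)` can be re-parametrised along ONE monoid isomorphism `e : P' ≃ P` with
`P' ⊆ ℤⁿ` finitely generated, saturated and spanning, without changing Kato's condition at any prime, AND the face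
fan of `P'^∨` is primitively simplicial (same construction as
`…FixedPointResolvableNhd.exists_normalized_chart_forall`, `P' = L⁻¹(ℤⁿ_{≥0})`). [cite: Kato1994, (1.5), Def. (2.1)]
[cite: Fulton1993Toric, §2.1] -/
theorem exists_normalized_chart_forall_isPrimSimplicial {A' : Type w} [AddCommGroup A'] (a : Fin n → A')
    {A : Type u} [CommRing A] (ha : ∀ i, IsOfFinAddOrder (a i))
    (φ : Multiplicative ↥(AddSubmonoid.nonneg (Fin n → ℤ) ⊓
      AddMonoidHom.mker (Fintype.linearCombination ℤ a).toAddMonoidHom) →* A) :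
    ∃ (P' : AddSubmonoid (Fin n → ℤ))
      (e : ↥P' ≃+ ↥(AddSubmonoid.nonneg (Fin n → ℤ) ⊓
        AddMonoidHom.mker (Fintype.linearCombination ℤ a).toAddMonoidHom))
      (hfg : P'.FG) (_ : P'.NSMulSaturated) (hspan : Submodule.span ℤ (P' : Set (Fin n → ℤ)) = ⊤),
      (∀ (𝔭 : Ideal A) [𝔭.IsPrime],
        (LogChart.IsLogRegularAt P' (φ.comp (AddMonoidHom.toMultiplicative e.toAddMonoidHom)) 𝔭 ↔
          LogChart.IsLogRegularAt _ φ 𝔭)) ∧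
      (Fan.ofCone (dualCone P') (dualCone_fg P' hfg) (isSalient_dualCone P' hspan)).IsPrimSimplicial := by
  -- adapted from `…FixedPointResolvableNhd.exists_normalized_chart_forall` (fan clause added)
  classical
  have hfgP := ChartMonoidFG.fg_nonneg_inf_mker a ha
  have hspanP := ChartNormalization.span_eq_ker a ha
  have hmemP := ChartNormalization.mem_chartMonoid_iff a
  have hNker : ∀ j : Fin n, ((∏ i, addOrderOf (a i) : ℕ) : ℤ) • (Pi.single j (1 : ℤ) : Fin n → ℤ) ∈
      LinearMap.ker (Fintype.linearCombination ℤ a) := fun j => by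
    have h := KernelLattice.range_smul_le_ker a ha ⟨Pi.single j 1, rfl⟩
    rw [LinearMap.smul_apply, LinearMap.id_apply, ← Nat.cast_prod] at h
    exact h
  generalize (AddSubmonoid.nonneg (Fin n → ℤ) ⊓
    AddMonoidHom.mker (Fintype.linearCombination ℤ a).toAddMonoidHom) = P at φ hfgP hspanP hmemP ⊢
  obtain ⟨L, hL, hrange⟩ := KernelLattice.exists_linearMap_range_eq_ker a ha
  let P' : AddSubmonoid (Fin n → ℤ) := P.comap L.toAddMonoidHom
  -- the monoid isomorphism `P' ≃ P`
  let f : ↥P' →+ ↥P :=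
    { toFun := fun p' => ⟨L p'.1, p'.2⟩
      map_zero' := Subtype.ext (map_zero L)
      map_add' := fun x y => Subtype.ext (map_add L x.1 y.1) }
  have hfinj : Function.Injective f := fun x y h =>
    Subtype.ext (hL (congrArg Subtype.val h))
  have hfsurj : Function.Surjective f := by
    rintro ⟨p, hp⟩
    have hpker : p ∈ LinearMap.ker (Fintype.linearCombination ℤ a) :=
      ((hmemP p).mp hp).2
    rw [← hrange] at hpker
    obtain ⟨v, hv⟩ := hpker
    refine ⟨⟨v, show L.toAddMonoidHom v ∈ P by rw [LinearMap.toAddMonoidHom_coe, hv]; exact hp⟩,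
      Subtype.ext hv⟩
  let e : ↥P' ≃+ ↥P := AddEquiv.ofBijective f ⟨hfinj, hfsurj⟩
  have heL : ∀ p' : ↥P', L p'.1 = (e p').1 := fun p' => rfl
  have himage : L '' (P' : Set (Fin n → ℤ)) = (P : Set (Fin n → ℤ)) := by
    ext p
    constructor
    · rintro ⟨v, hv, rfl⟩
      exact hv
    · intro hp
      obtain ⟨⟨v, hv⟩, hvp⟩ := hfsurj ⟨p, hp⟩
      exact ⟨v, hv, congrArg Subtype.val hvp⟩
  -- `P' = {v : L v ≥ 0}`
  have hP'mem : ∀ v, v ∈ P' ↔ 0 ≤ L v := fun v => by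
    change L.toAddMonoidHom v ∈ P ↔ _
    rw [LinearMap.toAddMonoidHom_coe, hmemP]
    constructor
    · exact fun h => h.1
    · intro h
      refine ⟨h, ?_⟩
      have hmem : L v ∈ LinearMap.range L := ⟨v, rfl⟩
      rw [hrange] at hmem
      exact hmem
  -- test vectors `uⱼ` with `L uⱼ = N eⱼ`
  have hu : ∀ j : Fin n, ∃ uj : Fin n → ℤ, L uj = ((∏ i, addOrderOf (a i) : ℕ) : ℤ) • Pi.single j 1 := by
    intro j
    have h := hNker j
    rw [← hrange] at h
    obtain ⟨uj, huj⟩ := h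
    exact ⟨uj, huj⟩
  choose u hu using hu
  have hN : 0 < ∏ i, addOrderOf (a i) := Finset.prod_pos fun i _ => (ha i).addOrderOf_pos
  have hfg' : P'.FG := by
    haveI : AddMonoid.FG ↥P := (AddMonoid.fg_iff_addSubmonoid_fg P).mpr hfgP
    have hfg' : AddMonoid.FG ↥P' := AddMonoid.fg_of_surjective e.symm.toAddMonoidHom e.symm.surjective
    exact (AddMonoid.fg_iff_addSubmonoid_fg P').mp hfg'
  have hspan' : Submodule.span ℤ (P' : Set (Fin n → ℤ)) = ⊤ := by
    apply Submodule.map_injective_of_injective hL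
    rw [Submodule.map_span, himage, hspanP, ← hrange, Submodule.map_top]
  refine ⟨P', e, hfg', ?_, hspan', fun 𝔭 _ => ?_, ?_⟩
  · -- saturated
    intro k v hkv
    by_cases hk : k = 0
    · exact Or.inl hk
    · right
      rw [hP'mem] at hkv ⊢
      rw [map_nsmul] at hkv
      intro i
      have h := hkv i
      simp only [Pi.smul_apply, nsmul_eq_mul, Pi.zero_apply] at h
      have hkpos : (0 : ℤ) < k := by exact_mod_cast Nat.pos_of_ne_zero hk
      exact (mul_nonneg_iff_of_pos_left hkpos).mp h
  · exact LogChartTransport.isLogRegularAt_comp_iff P P' e φ L hL heL 𝔭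
  · exact isPrimSimplicial_ofCone_dualCone_of_preimage_orthant L P' hP'mem _ hN u hu hfg' hspan'

end Summit.ResolutionOfSingularities.ResolutionOfSingularities.Theorems.FRationalResolution.SimplicialNormalization
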